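import Mathlib
import HarnessLib
import Literature.Geometry.Lorentzian.Stationary
import Literature.Geometry.Lorentzian.IPlusRegular
import Literature.Geometry.Lorentzian.Einstein
import Literature.Geometry.Lorentzian.CausalityOpennessProofs
import Literature.Geometry.Lorentzian.DocProductStructure

/-!
# `NonTrappingHawkingRigidity` (crux stmt-FinalStateConjecture-13896), line `azimuthal-partial-analyticity` —
# stub `stub_invariantRadialFunctionConnected` (S1b₇ = S1b + (R7))

Registered stub S1b₇ of the lead's skeleton (rev 6), namespace
`…Theorems.NonTrappingHawkingRigidity.AzimuthalPartialAnalyticity`, `stub_invariantRadialFunctionConnected`,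
PROVED.  The statement below is the REGISTERED signature, letter for letter (Literature vocabulary only): it
is the landed stub S1b `stub_invariantRadialFunction` (clauses (R1)–(R6), same proof, same witness) with ONE
extra final conjunct (R7), the preconnectedness of the sub-levels `{ρ < c} ∩ doc`, which the far axial seed
(N1) consumes to put the whole sub-collar trace in one component of the axial collar.  (R7) cannot be read
off the landed `∃ ρ, (R1) ∧ … ∧ (R6)`, whence the verbatim copy of its proof for the same witness.

**Statement (the `T`-invariant radial function of the d.o.c.).** Granted the Chruściel–Costa product
structure of the domain of outer communications (the named fact `chruscielCosta2008_docProductStructure`,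
first hypothesis: maps `Ψ : ℝ × ℝ³ → M`, `Φ : M → ℝ × ℝ³`, mutually inverse between the closed exterior
`ℝ × {1 ≤ ‖x‖}` and `⟨⟨M_ext⟩⟩ ∪ 𝓔⁺`, bi-continuous there, `C^∞` in both directions between the open
exterior and `⟨⟨M_ext⟩⟩`, taking the unit cylinder onto `𝓔⁺`, with every line `t ↦ Ψ (t, x)` an integral
curve of the stationary Killing field `T`), every vacuum `I⁺`-regular stationary black hole `𝓑` with simply
connected d.o.c. and connected horizon carries a function `ρ` on space-time which is (R1) `C^∞` on the
d.o.c., (R2) `T`-invariant, `dρ(T) = 0`, (R3) submersive, `dρ ≠ 0` on the d.o.c., (R4) whose sub-levels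
`{ρ < c} ∩ doc`, `c > 0`, are the traces on the d.o.c. of open neighbourhoods of `𝓔⁺`, (R5) which is thin
below every open `U₁ ⊇ 𝓔⁺` with flow-invariant trace (`{ρ < c} ∩ doc ⊆ U₁` for some `c > 0`), (R6) whose
slabs `{c₀ ≤ ρ ≤ c} ∩ doc`, `c₀ > 0`, lie in the `T`-orbit of a compact subset of the d.o.c., and (R7) whose
sub-levels `{ρ < c} ∩ doc`, `c > 0`, are preconnected.  (The hypotheses "future-presented" and "`T ≠ 0` on
the d.o.c." of the registered signature are not used.)

**Proof (chart bookkeeping over the product structure).** `ρ := ‖(Φ ·).2‖ - 1`, i.e. `ρ (Ψ (t, x)) = ‖x‖ - 1`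
on the closed exterior.  (R1) `Φ` is `C^∞` on the d.o.c. and `z ↦ ‖z.2‖ - 1` is `C^∞` off `{z.2 = 0}`
(`ContDiffAt.norm`), while `‖(Φ p).2‖ > 1` on the d.o.c.  (R2) along the integral curve `t ↦ Ψ (t, x)`
through `p = Ψ (t₀, x)` the composite `ρ ∘ γ ≡ ‖x‖ - 1` is constant, so the chain rule
(`HasMFDerivAt.comp`, uniqueness of derivatives on `ℝ`) gives `dρ_p (T p) = 0`.  (R3) if `dρ_p = 0` at
`p = Ψ z₀` then `ρ ∘ Ψ` has zero derivative at `z₀` (`Ψ` is differentiable on the open exterior), whereas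
along the ray `s ↦ (z₀.1, (1 + s) • z₀.2)` it equals `(1 + s)‖z₀.2‖ - 1` near `s = 0`, of derivative
`‖z₀.2‖ > 1`.  (R4) `Φ` is continuous on `doc ∪ 𝓔⁺`, so the preimage of the open set `{‖z.2‖ < 1 + c}` is the
trace of an open `U'` (`continuousOn_iff'`); `U' ⊇ 𝓔⁺` because `‖(Φ p).2‖ = 1` on `𝓔⁺`.  (R5) the set of
`x`, `1 ≤ ‖x‖`, with `Ψ (0, x) ∈ U₁` is the trace of an open `V ⊆ ℝ³` containing the unit sphere
(`Ψ (0, x) ∈ 𝓔⁺ ⊆ U₁` for `‖x‖ = 1`); by compactness some `δ`-thickening of the sphere lies in `V`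
(`IsCompact.exists_thickening_subset_open`), so `Ψ (0, x) ∈ U₁ ∩ doc` for `1 < ‖x‖ < 1 + δ`, and
flow-invariance of `U₁ ∩ doc` along `t ↦ Ψ (t, x)` gives `Ψ (t, x) ∈ U₁`, i.e. `{ρ < δ} ∩ doc ⊆ U₁`.
(R6) `S := Ψ ({0} × {1 + c₀ ≤ ‖x‖ ≤ 1 + c})` is a compact subset of the d.o.c. (continuous image of a
compact shell) and `p = Ψ (t, x)` with `c₀ ≤ ρ p ≤ c` lies on the integral curve `t ↦ Ψ (t, x)` issuing
from `Ψ (0, x) ∈ S`.  (R7) `{ρ < c} ∩ doc = Ψ (ℝ × {1 < ‖x‖ < 1 + c})` is the continuous image of the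
product of `ℝ` with an open annulus of `ℝ³`, itself the image of `S² × (1, 1 + c)` under `(u, r) ↦ r • u`
(`isPreconnected_sphere`, `1 < rank ℝ³`; `IsPreconnected.prod`, `IsPreconnected.image`).

References: P. T. Chruściel, J. L. Costa, Astérisque 321 (2008) 195–265 = arXiv:0806.0016, §4.2, Thm. 4.5
and (4.11) (the product structure `⟨⟨M_ext⟩⟩ ≈ ℝ × 𝒮̊₀`, flow = translation) [ChruscielCosta2008];
P. T. Chruściel, R. M. Wald, Class. Quantum Grav. 11 (1994) L147, Thm. 2.3 [ChruscielWald1994Topology];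
J. M. Lee, *Introduction to Smooth Manifolds*, 2nd ed., Prop. 3.6 / Thm. 9.12 (chain rule, integral curves)
[LeeSmoothManifolds2013].
-/

noncomputable section

-- D-0017: single-problem summit, `Summit.<S>.<S>.…` by design
set_option linter.dupNamespace false

namespace Summit.FinalStateConjecture.FinalStateConjecture.Theorems.NonTrappingHawkingRigidity.AzimuthalPartialAnalyticity

open Set Filter Function Bundle Metric Literature.Geometry.Lorentzian
open scoped Manifold ContDiff Topology

section General

variable {F : Type*} [NormedAddCommGroup F] [NormedSpace ℝ F]

/-- The radial ray computation: `s ↦ ‖(1 + s) • y‖ - 1 = (1 + s)‖y‖ - 1` near `s = 0` has derivative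
`‖y‖` at `0`. Elementary calculus. [folklore] -/
private theorem hasDerivAt_norm_one_add_smul_sub (y : F) :
    HasDerivAt (fun s : ℝ ↦ ‖(1 + s) • y‖ - 1) ‖y‖ 0 := by
  have h : HasDerivAt (fun s : ℝ ↦ (1 + s) * ‖y‖ - 1) ‖y‖ 0 := by
    simpa using (((hasDerivAt_id (0 : ℝ)).const_add 1).mul_const ‖y‖).sub_const 1
  refine h.congr_of_eventuallyEq ?_
  filter_upwards [Ioi_mem_nhds (show (-1 : ℝ) < 0 by norm_num)] with s hs
  rw [norm_smul, Real.norm_of_nonneg (by linarith [mem_Ioi.1 hs])]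

/-- A point of the shell `1 ≤ ‖x‖ < 1 + δ` is within distance `δ` of the unit sphere (its radial
projection `‖x‖⁻¹ • x` is at distance `‖x‖ - 1`). Elementary. [folklore] -/
private theorem mem_thickening_sphere_of_norm_lt {x : F} {δ : ℝ} (h1 : 1 ≤ ‖x‖) (h2 : ‖x‖ < 1 + δ) :
    x ∈ thickening δ (sphere (0 : F) 1) := by
  have hx0 : ‖x‖ ≠ 0 := (one_pos.trans_le h1).ne'
  refine mem_thickening_iff.2 ⟨‖x‖⁻¹ • x, ?_, ?_⟩
  · rw [mem_sphere_zero_iff_norm, norm_smul, norm_inv, norm_norm, inv_mul_cancel₀ hx0]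
  · rw [dist_eq_norm]
    calc ‖x - ‖x‖⁻¹ • x‖ = ‖(1 - ‖x‖⁻¹) • x‖ := by rw [sub_smul, one_smul]
      _ = (1 - ‖x‖⁻¹) * ‖x‖ := by
          rw [norm_smul, Real.norm_of_nonneg (sub_nonneg.2 (inv_le_one_of_one_le₀ h1))]
      _ = ‖x‖ - 1 := by field_simp
      _ < δ := by linarith

end General

/-- The open annulus `{a < ‖x‖ < b}` of `ℝ³` (`a > 0`) is preconnected: it is the image of
`sphere 0 1 ×ˢ (a, b)` under `(u, r) ↦ r • u`, and the unit sphere of `ℝ³` is connected (`1 < rank`).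
[folklore] -/
-- adapted from `isPreconnected_openAnnulus` (Literature/Geometry/Lorentzian/MassCapacityRigidityHarmonic.lean)
private theorem isPreconnected_openAnnulus_E3 {a b : ℝ} (ha : 0 < a) :
    IsPreconnected {x : E3 | a < ‖x‖ ∧ ‖x‖ < b} := by
  have himage : {x : E3 | a < ‖x‖ ∧ ‖x‖ < b} =
      (fun p : E3 × ℝ ↦ p.2 • p.1) '' (sphere (0 : E3) 1 ×ˢ Ioo a b) := by
    ext x
    simp only [mem_setOf_eq, mem_image, mem_prod, mem_sphere_zero_iff_norm, mem_Ioo, Prod.exists]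
    constructor
    · rintro ⟨ha', hb'⟩
      have hx0 : 0 < ‖x‖ := ha.trans ha'
      refine ⟨‖x‖⁻¹ • x, ‖x‖, ⟨?_, ha', hb'⟩, ?_⟩
      · rw [norm_smul, norm_inv, norm_norm, inv_mul_cancel₀ hx0.ne']
      · rw [smul_smul, mul_inv_cancel₀ hx0.ne', one_smul]
    · rintro ⟨y, r, ⟨hy, har, hrb⟩, rfl⟩
      have hr : 0 < r := ha.trans har
      rw [norm_smul, Real.norm_of_nonneg hr.le, hy, mul_one]
      exact ⟨har, hrb⟩
  rw [himage]
  have hE : 1 < Module.rank ℝ E3 :=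
    Module.one_lt_rank_of_one_lt_finrank (by rw [finrank_euclideanSpace_fin]; norm_num)
  exact ((isPreconnected_sphere hE 0 1).prod isPreconnected_Ioo).image _
    (continuous_snd.smul continuous_fst).continuousOn

-- `TangentSpace 𝓘(ℝ, ℝ) t` / `TangentSpace 𝓘(ℝ, ℝ × E3) z` are definitionally `ℝ` / `ℝ × E3`; reading manifold
-- derivatives of real functions along curves and rays as ordinary derivatives moves across this
-- identification — as in Mathlib's `IsMIntegralCurveOn.hasDerivWithinAt` (same option, same pattern).
set_option backward.isDefEq.respectTransparency false in
/-- **Stub S1b₇ `stub_invariantRadialFunctionConnected` (registered signature, letter for letter): the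
`T`-invariant radial function of the domain of outer communications, with preconnected sub-levels.**
Granted the Chruściel–Costa product structure `Ψ : ℝ × {1 ≤ ‖x‖} ≈ ⟨⟨M_ext⟩⟩ ∪ 𝓔⁺` (first hypothesis,
the named fact `chruscielCosta2008_docProductStructure`), the function `ρ := ‖(Φ ·).2‖ - 1`, `Φ` the
inverse chart (`ρ (Ψ (t, x)) = ‖x‖ - 1`; on Kerr `r - r₊` up to reparametrisation), is `C^∞` on the
d.o.c. (R1), `T`-invariant (R2), submersive (R3), its sub-levels are traces of open neighbourhoods of `𝓔⁺`
(R4), it is thin below every open flow-invariant neighbourhood of `𝓔⁺` (R5), its slabs are compact modulo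
the flow of `T` (R6), and its sub-levels `{ρ < c} ∩ doc = Ψ (ℝ × {1 < ‖x‖ < 1 + c})` are preconnected
(R7); see the module docstring for the proof (chart bookkeeping: chain rule, `continuousOn_iff'`, a
thickening of the compact unit sphere, continuous images of a compact shell and of `ℝ ×` an open annulus
of `ℝ³`).  Chruściel–Costa 2008, Thm. 4.5 and (4.11). [cite: ChruscielCosta2008, Thm. 4.5, (4.11)] -/
theorem stub_invariantRadialFunctionConnected :
    chruscielCosta2008_docProductStructure →
    ∀ (𝓑 : StationaryAFBlackHole.{0}) [𝓑.metric.HasLeviCivita],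
      𝓑.metric.toPseudoRiemannianMetric.IsRicciFlat → 𝓑.IsIPlusRegular →
      (∀ p : 𝓑.carrier, p ∈ 𝓑.metric.chronologicalFuture 𝓑.timeOrientation 𝓑.Mext) →
      (∀ p ∈ 𝓑.doc, 𝓑.killing p ≠ 0) → SimplyConnectedSpace 𝓑.doc → IsConnected 𝓑.horizon →
      ∃ ρ : 𝓑.carrier → ℝ,
        ContMDiffOn (𝓡 4) 𝓘(ℝ, ℝ) ((⊤ : ℕ∞) : WithTop ℕ∞) ρ 𝓑.doc ∧
        (∀ x ∈ 𝓑.doc, mfderiv (𝓡 4) 𝓘(ℝ, ℝ) ρ x (𝓑.killing x) = 0) ∧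
        (∀ x ∈ 𝓑.doc, mfderiv (𝓡 4) 𝓘(ℝ, ℝ) ρ x ≠ 0) ∧
        (∀ c : ℝ, 0 < c → ∃ U' : Set 𝓑.carrier, IsOpen U' ∧ 𝓑.horizon ⊆ U' ∧
          U' ∩ 𝓑.doc = {x | x ∈ 𝓑.doc ∧ ρ x < c}) ∧
        (∀ U₁ : Set 𝓑.carrier, IsOpen U₁ → 𝓑.horizon ⊆ U₁ →
          (∀ γ : ℝ → 𝓑.carrier, IsMIntegralCurve γ 𝓑.killing → γ 0 ∈ U₁ ∩ 𝓑.doc →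
            ∀ t, γ t ∈ U₁ ∩ 𝓑.doc) →
          ∃ c : ℝ, 0 < c ∧ {x | x ∈ 𝓑.doc ∧ ρ x < c} ⊆ U₁) ∧
        (∀ c₀ c : ℝ, 0 < c₀ → ∃ S : Set 𝓑.carrier, IsCompact S ∧ S ⊆ 𝓑.doc ∧
          {x | x ∈ 𝓑.doc ∧ c₀ ≤ ρ x ∧ ρ x ≤ c} ⊆ stationaryOrbit 𝓑.killing S) ∧
        (∀ c : ℝ, 0 < c → IsPreconnected {x | x ∈ 𝓑.doc ∧ ρ x < c}) := by
  intro hfact 𝓑 _ hvac hreg _hfut _hT hsc hconn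
  obtain ⟨Ψ, Φ, hΦΨ, -, hdoc, hhor, hΨc, hΦc, hΨs, hΦs, hflow⟩ := hfact 𝓑 hvac hreg hsc hconn
  /- (0) bookkeeping: the d.o.c. is open, the open exterior is open, points of `doc`/`𝓔⁺` in the chart -/
  have hopen : IsOpen 𝓑.doc :=
    𝓑.isOpen_doc LorentzianMetric.isOpen_chronologicalFuture_holds_of_boundaryless
      LorentzianMetric.isOpen_chronologicalPast_holds_of_boundaryless
  have hO : IsOpen {z : ℝ × E3 | 1 < ‖z.2‖} :=
    isOpen_lt continuous_const (continuous_norm.comp continuous_snd)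
  have hmem_doc : ∀ z : ℝ × E3, 1 < ‖z.2‖ → Ψ z ∈ 𝓑.doc := fun z hz ↦
    hdoc ▸ mem_image_of_mem Ψ hz
  have hmem_hor : ∀ z : ℝ × E3, ‖z.2‖ = 1 → Ψ z ∈ 𝓑.horizon := fun z hz ↦
    hhor ▸ mem_image_of_mem Ψ hz
  have hdoc' : ∀ p ∈ 𝓑.doc, 1 < ‖(Φ p).2‖ := by
    intro p hp
    rw [← hdoc] at hp
    obtain ⟨z, hz, rfl⟩ := hp
    rw [hΦΨ z (le_of_lt hz)]
    exact hz
  /- the slice map `x ↦ Ψ (0, x)` is continuous on the closed exterior region of `ℝ³` -/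
  have hfc : ContinuousOn (fun x : E3 ↦ Ψ ((0 : ℝ), x)) {x : E3 | 1 ≤ ‖x‖} :=
    hΨc.comp (f := fun x : E3 ↦ ((0 : ℝ), x)) (by fun_prop) fun x hx ↦ hx
  /- the radial function -/
  set g : ℝ × E3 → ℝ := fun z ↦ ‖z.2‖ - 1 with hg
  have hgs : ∀ z : ℝ × E3, z.2 ≠ 0 → ContDiffAt ℝ ∞ g z := fun z hz ↦
    (contDiffAt_snd.norm ℝ hz).sub contDiffAt_const
  set ρ : 𝓑.carrier → ℝ := g ∘ Φ with hρ
  have hρΨ : ∀ z : ℝ × E3, 1 ≤ ‖z.2‖ → ρ (Ψ z) = ‖z.2‖ - 1 := by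
    intro z hz
    simp only [hρ, hg, Function.comp_apply, hΦΨ z hz]
  /- (R1) smoothness on the d.o.c. -/
  have hR1 : ContMDiffOn (𝓡 4) 𝓘(ℝ, ℝ) ((⊤ : ℕ∞) : WithTop ℕ∞) ρ 𝓑.doc := by
    intro p hp
    refine (hgs (Φ p) ?_).comp_contMDiffWithinAt (hΦs p hp)
    intro h0
    have h1 := hdoc' p hp
    rw [h0, norm_zero] at h1
    exact absurd h1 (by norm_num)
  have hmd : ∀ p ∈ 𝓑.doc, HasMFDerivAt (𝓡 4) 𝓘(ℝ, ℝ) ρ p (mfderiv (𝓡 4) 𝓘(ℝ, ℝ) ρ p) :=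
    fun p hp ↦ ((hR1.contMDiffAt (hopen.mem_nhds hp)).mdifferentiableAt (by simp)).hasMFDerivAt
  refine ⟨ρ, hR1, ?_, ?_, ?_, ?_, ?_, ?_⟩
  /- (R2) `T`-invariance: `ρ` is constant along the integral curves `t ↦ Ψ (t, x)` -/
  · intro x hx
    rw [← hdoc] at hx
    obtain ⟨⟨t₀, y⟩, hy, rfl⟩ := hx
    have hy' : 1 < ‖y‖ := hy
    have h1 : HasMFDerivAt 𝓘(ℝ, ℝ) (𝓡 4) (fun t : ℝ ↦ Ψ (t, y)) t₀
        ((1 : ℝ →L[ℝ] ℝ).smulRight (𝓑.killing (Ψ (t₀, y)))) := hflow y hy'.le t₀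
    have h2 : HasMFDerivAt 𝓘(ℝ, ℝ) 𝓘(ℝ, ℝ) (ρ ∘ fun t : ℝ ↦ Ψ (t, y)) t₀
        ((mfderiv (𝓡 4) 𝓘(ℝ, ℝ) ρ (Ψ (t₀, y))).comp
          ((1 : ℝ →L[ℝ] ℝ).smulRight (𝓑.killing (Ψ (t₀, y))))) :=
      HasMFDerivAt.comp t₀ (hmd _ (hmem_doc _ hy')) h1
    have h3 : HasMFDerivAt 𝓘(ℝ, ℝ) 𝓘(ℝ, ℝ) (ρ ∘ fun t : ℝ ↦ Ψ (t, y)) t₀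
        (0 : TangentSpace 𝓘(ℝ, ℝ) t₀ →L[ℝ] TangentSpace 𝓘(ℝ, ℝ) ((ρ ∘ fun t : ℝ ↦ Ψ (t, y)) t₀)) := by
      have hconst : (ρ ∘ fun t : ℝ ↦ Ψ (t, y)) = fun _ ↦ ‖y‖ - 1 := by
        funext t
        exact hρΨ (t, y) hy'.le
      rw [hconst]
      exact hasMFDerivAt_const _ _
    -- evaluate the identity `dρ ∘ (r ↦ r • T) = 0` of linear maps `ℝ → ℝ` at `1`
    have h4 : mfderiv (𝓡 4) 𝓘(ℝ, ℝ) ρ (Ψ (t₀, y)) ((1 : ℝ) • 𝓑.killing (Ψ (t₀, y))) = 0 :=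
      DFunLike.congr_fun (hasMFDerivAt_unique h2 h3) (1 : ℝ)
    rwa [one_smul] at h4
  /- (R3) `dρ ≠ 0`: along the radial ray through `z₀ = Φ x` the composite `ρ ∘ Ψ` has derivative `‖z₀.2‖` -/
  · intro x hx h0
    rw [← hdoc] at hx
    obtain ⟨z₀, hz₀, rfl⟩ := hx
    have hz₀' : 1 < ‖z₀.2‖ := hz₀
    have hΨd : HasMFDerivAt 𝓘(ℝ, ℝ × E3) (𝓡 4) Ψ z₀ (mfderiv 𝓘(ℝ, ℝ × E3) (𝓡 4) Ψ z₀) :=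
      ((hΨs.contMDiffAt (hO.mem_nhds hz₀)).mdifferentiableAt (by simp)).hasMFDerivAt
    have h1 : HasMFDerivAt 𝓘(ℝ, ℝ × E3) 𝓘(ℝ, ℝ) (ρ ∘ Ψ) z₀
        ((0 : TangentSpace (𝓡 4) (Ψ z₀) →L[ℝ] TangentSpace 𝓘(ℝ, ℝ) (ρ (Ψ z₀))).comp
          (mfderiv 𝓘(ℝ, ℝ × E3) (𝓡 4) Ψ z₀)) := by
      have := HasMFDerivAt.comp z₀ (hmd _ (hmem_doc z₀ hz₀')) hΨd
      rwa [h0] at this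
    -- the radial ray `ℓ s := (z₀.1, (1 + s) • z₀.2)` through `ℓ 0 = z₀`
    have hℓ : HasDerivAt (fun s : ℝ ↦ ((z₀.1 : ℝ), (1 + s) • z₀.2)) ((0 : ℝ), (1 : ℝ) • z₀.2) 0 :=
      (hasDerivAt_const (0 : ℝ) z₀.1).prodMk (((hasDerivAt_id' (0 : ℝ)).const_add 1).smul_const z₀.2)
    -- `ρ ∘ Ψ ∘ ℓ` has derivative `0 = (0 ∘ dΨ) ℓ'(0)` at `0` (read in the vector space `ℝ × ℝ³`)
    have h3 := (hasMFDerivAt_iff_hasFDerivAt.1 h1).comp_hasDerivAt_of_eq (0 : ℝ) hℓ (by simp)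
    have h4 : HasDerivAt ((ρ ∘ Ψ) ∘ fun s : ℝ ↦ ((z₀.1 : ℝ), (1 + s) • z₀.2)) ‖z₀.2‖ 0 := by
      refine (hasDerivAt_norm_one_add_smul_sub z₀.2).congr_of_eventuallyEq ?_
      have hn : (fun s : ℝ ↦ ((z₀.1 : ℝ), (1 + s) • z₀.2)) ⁻¹' {z : ℝ × E3 | 1 < ‖z.2‖} ∈ 𝓝 (0 : ℝ) :=
        hℓ.continuousAt.preimage_mem_nhds (hO.mem_nhds (by simpa using hz₀'))
      filter_upwards [hn] with s hs
      have hs' : 1 < ‖((1 : ℝ) + s) • z₀.2‖ := hs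
      exact hρΨ ((z₀.1 : ℝ), (1 + s) • z₀.2) hs'.le
    have h5 : ‖z₀.2‖ = 0 := h4.unique h3
    linarith
  /- (R4) the sub-levels `{ρ < c} ∩ doc` are traces of open neighbourhoods of `𝓔⁺` -/
  · intro c hc
    obtain ⟨V, hV, hVeq⟩ := (_root_.continuousOn_iff'.1 hΦc) {z : ℝ × E3 | ‖z.2‖ < 1 + c}
      (isOpen_lt (continuous_norm.comp continuous_snd) continuous_const)
    refine ⟨V, hV, ?_, ?_⟩
    · intro p hp
      have hp' : p ∈ Φ ⁻¹' {z : ℝ × E3 | ‖z.2‖ < 1 + c} ∩ (𝓑.doc ∪ 𝓑.horizon) := by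
        refine ⟨?_, Or.inr hp⟩
        rw [← hhor] at hp
        obtain ⟨z, hz, rfl⟩ := hp
        have hz' : ‖z.2‖ = 1 := hz
        show ‖(Φ (Ψ z)).2‖ < 1 + c
        rw [hΦΨ z hz'.ge, hz']
        linarith
      rw [hVeq] at hp'
      exact hp'.1
    · ext p
      constructor
      · rintro ⟨hpV, hpd⟩
        have hp' : p ∈ V ∩ (𝓑.doc ∪ 𝓑.horizon) := ⟨hpV, Or.inl hpd⟩
        rw [← hVeq] at hp'
        have h1 : ‖(Φ p).2‖ < 1 + c := hp'.1
        refine ⟨hpd, ?_⟩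
        show ‖(Φ p).2‖ - 1 < c
        linarith
      · rintro ⟨hpd, hpc⟩
        have hpc' : ‖(Φ p).2‖ - 1 < c := hpc
        have hp' : p ∈ Φ ⁻¹' {z : ℝ × E3 | ‖z.2‖ < 1 + c} ∩ (𝓑.doc ∪ 𝓑.horizon) := by
          refine ⟨?_, Or.inl hpd⟩
          show ‖(Φ p).2‖ < 1 + c
          linarith
        rw [hVeq] at hp'
        exact ⟨hp'.1, hpd⟩
  /- (R5) thin below every open `U₁ ⊇ 𝓔⁺` with flow-invariant trace on the d.o.c. -/
  · intro U₁ hU₁ hhorU₁ hinv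
    obtain ⟨V, hV, hVeq⟩ := (_root_.continuousOn_iff'.1 hfc) U₁ hU₁
    have hsph : sphere (0 : E3) 1 ⊆ V := by
      intro x hx
      have hx1 : ‖x‖ = 1 := mem_sphere_zero_iff_norm.1 hx
      have hx' : x ∈ (fun x : E3 ↦ Ψ ((0 : ℝ), x)) ⁻¹' U₁ ∩ {x : E3 | 1 ≤ ‖x‖} :=
        ⟨hhorU₁ (hmem_hor ((0 : ℝ), x) hx1), hx1.ge⟩
      rw [hVeq] at hx'
      exact hx'.1
    obtain ⟨δ, hδ, hδV⟩ := (isCompact_sphere (0 : E3) 1).exists_thickening_subset_open hV hsph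
    refine ⟨δ, hδ, ?_⟩
    rintro p ⟨hp, hpδ⟩
    rw [← hdoc] at hp
    obtain ⟨⟨t₀, y⟩, hy, rfl⟩ := hp
    have hy' : 1 < ‖y‖ := hy
    rw [hρΨ (t₀, y) hy'.le] at hpδ
    have hpδ' : ‖y‖ - 1 < δ := hpδ
    have hyV : y ∈ V := hδV (mem_thickening_sphere_of_norm_lt hy'.le (by linarith))
    have hy0 : Ψ ((0 : ℝ), y) ∈ U₁ := by
      have hy'' : y ∈ V ∩ {x : E3 | 1 ≤ ‖x‖} := ⟨hyV, hy'.le⟩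
      rw [← hVeq] at hy''
      exact hy''.1
    exact (hinv (fun t ↦ Ψ (t, y)) (hflow y hy'.le) ⟨hy0, hmem_doc ((0 : ℝ), y) hy'⟩ t₀).1
  /- (R6) the slabs `{c₀ ≤ ρ ≤ c} ∩ doc` are compact modulo the flow of `T` -/
  · intro c₀ c hc₀
    set K : Set E3 := {x : E3 | 1 + c₀ ≤ ‖x‖ ∧ ‖x‖ ≤ 1 + c} with hK
    have hKc : IsCompact K := by
      have hK' : K = closedBall (0 : E3) (1 + c) ∩ {x : E3 | 1 + c₀ ≤ ‖x‖} := by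
        ext x
        simp only [hK, mem_setOf_eq, mem_inter_iff, mem_closedBall_zero_iff]
        exact and_comm
      rw [hK']
      exact (isCompact_closedBall _ _).inter_right (isClosed_le continuous_const continuous_norm)
    have hKsub : K ⊆ {x : E3 | 1 ≤ ‖x‖} := fun x hx ↦ le_trans (by linarith) hx.1
    refine ⟨(fun x : E3 ↦ Ψ ((0 : ℝ), x)) '' K, hKc.image_of_continuousOn (hfc.mono hKsub), ?_, ?_⟩
    · rintro _ ⟨x, hx, rfl⟩
      exact hmem_doc ((0 : ℝ), x) (show 1 < ‖x‖ by linarith [hx.1])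
    · rintro p ⟨hp, h1, h2⟩
      rw [← hdoc] at hp
      obtain ⟨⟨t₀, y⟩, hy, rfl⟩ := hp
      have hy' : 1 < ‖y‖ := hy
      rw [hρΨ (t₀, y) hy'.le] at h1 h2
      have h1' : c₀ ≤ ‖y‖ - 1 := h1
      have h2' : ‖y‖ - 1 ≤ c := h2
      exact ⟨fun t ↦ Ψ (t, y), hflow y hy'.le,
        mem_image_of_mem (fun x : E3 ↦ Ψ ((0 : ℝ), x)) ⟨by linarith, by linarith⟩, t₀, rfl⟩
  /- (R7) the sub-levels `{ρ < c} ∩ doc = Ψ (ℝ × {1 < ‖x‖ < 1 + c})` are preconnected -/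
  · intro c _hc
    have hA : IsPreconnected ((univ : Set ℝ) ×ˢ {x : E3 | 1 < ‖x‖ ∧ ‖x‖ < 1 + c}) :=
      isPreconnected_univ.prod (isPreconnected_openAnnulus_E3 one_pos)
    have heq : {x | x ∈ 𝓑.doc ∧ ρ x < c} =
        Ψ '' ((univ : Set ℝ) ×ˢ {x : E3 | 1 < ‖x‖ ∧ ‖x‖ < 1 + c}) := by
      ext p
      constructor
      · rintro ⟨hp, hpc⟩
        rw [← hdoc] at hp
        obtain ⟨⟨t₀, y⟩, hy, rfl⟩ := hp
        have hy' : 1 < ‖y‖ := hy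
        rw [hρΨ (t₀, y) hy'.le] at hpc
        have hpc' : ‖y‖ - 1 < c := hpc
        exact ⟨(t₀, y), mem_prod.2 ⟨mem_univ _, hy', by linarith⟩, rfl⟩
      · rintro ⟨⟨t₀, y⟩, hz, rfl⟩
        have hy : 1 < ‖y‖ ∧ ‖y‖ < 1 + c := (mem_prod.1 hz).2
        refine ⟨hmem_doc (t₀, y) hy.1, ?_⟩
        show ρ (Ψ (t₀, y)) < c
        rw [hρΨ (t₀, y) hy.1.le]
        show ‖y‖ - 1 < c
        linarith [hy.2]
    rw [heq]
    exact hA.image Ψ (hΨc.mono fun z hz ↦ (show 1 < ‖z.2‖ from (mem_prod.1 hz).2.1).le)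

end Summit.FinalStateConjecture.FinalStateConjecture.Theorems.NonTrappingHawkingRigidity.AzimuthalPartialAnalyticity

end
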